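import Mathlib.Analysis.SpecialFunctions.ImproperIntegrals
import Literature.Analysis.FluidPDE.StretchedLayerNSBurgers
import Literature.Analysis.FluidPDE.StretchedLayerShearTails
import HarnessLib

/-!
# Gaussian tails of the Burgers shear layer; the laminar state has shear-layer tails

Analysis/FluidPDE file, everything proved (companion of `StretchedLayerNSBurgers.lean`). For the Burgers
layer profile `U_B = burgersLayerProfile γ ν ΔU` (`γ, ν > 0`, `ΔU ≥ 0`, `κ = (γ/2ν)^{1/2}`):

* `U_B'(s) ≤ (ΔU/√π) κ e^{1/4} e^{−κ|s|}`, `|U_B''(s)| ≤ 2κ²(ΔU/√π) e · e^{−κ|s|}`;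
* `ΔU/2 − U_B(y) ≤ (ΔU/√π) e^{1/4} e^{−κy}` for `y ≥ 0` (integrate the tail of `U_B'` over `(y, ∞)`), the mirror
  bound for `y ≤ 0`, and `|U_B² − ΔU²/4| ≤ ΔU (ΔU/√π) e^{1/4} e^{−κ|y|}`;
* hence, for `ΔU = 1`, the Burgers shear layer `(burgersShearLayer γ ν 1, 0)` has SHEAR-LAYER TAILS
  (`HasShearLayerTails`, `StretchedLayerShearTails.lean`): the physical side condition recommended for the
  strained-layer statements is satisfied by the laminar state (non-vacuity of the repaired class).

Elementary inequalities: `e^{−(κs)²} ≤ e^{1/4} e^{−κ|s|}` and `κ|s| e^{−(κs)²} ≤ e · e^{−κ|s|}` (complete the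
square). References: Majda–Bertozzi 2002 §1.4 Ex. 1.8 (1.48); Burgers 1948.
-/

noncomputable section

open Set Function Filter
open _root_.MeasureTheory _root_.Topology
open scoped ENNReal

namespace Literature.Analysis.FluidPDE

open StretchedLayer

/-! ### Gaussian tails in exponential dress -/

/-- Completing the square: `e^{−(κs)²} ≤ e^{1/4} · e^{−κ|s|}`. [folklore] -/
theorem exp_neg_mul_sq_le_exp_neg_abs (κ s : ℝ) :
    Real.exp (-(κ * s) ^ 2) ≤ Real.exp (1 / 4) * Real.exp (-κ * |s|) := by
  rw [← Real.exp_add]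
  apply Real.exp_le_exp.2
  have h1 : (κ * s) ^ 2 = (κ * |s|) ^ 2 := by rw [mul_pow, mul_pow, sq_abs]
  nlinarith [sq_nonneg (κ * |s| - 1 / 2)]

/-- Completing the square: `κ|s| e^{−(κs)²} ≤ e · e^{−κ|s|}` for `κ ≥ 0`. [folklore] -/
theorem mul_abs_mul_exp_neg_mul_sq_le {κ : ℝ} (hκ : 0 ≤ κ) (s : ℝ) :
    κ * |s| * Real.exp (-(κ * s) ^ 2) ≤ Real.exp 1 * Real.exp (-κ * |s|) := by
  set a : ℝ := κ * |s| with ha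
  have ha0 : 0 ≤ a := mul_nonneg hκ (abs_nonneg s)
  have h1 : a ≤ Real.exp a := by linarith [Real.add_one_le_exp a]
  have h2 : (κ * s) ^ 2 = a ^ 2 := by rw [ha, mul_pow, mul_pow, sq_abs]
  calc a * Real.exp (-(κ * s) ^ 2) ≤ Real.exp a * Real.exp (-(κ * s) ^ 2) :=
        mul_le_mul_of_nonneg_right h1 (Real.exp_pos _).le
    _ = Real.exp (a + -(κ * s) ^ 2) := (Real.exp_add _ _).symm
    _ ≤ Real.exp (1 + -κ * |s|) := Real.exp_le_exp.2 (by rw [h2]; nlinarith [sq_nonneg (a - 1)])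
    _ = Real.exp 1 * Real.exp (-κ * |s|) := Real.exp_add _ _

/-- **Tail of `U_B'`**: `U_B'(s) ≤ (ΔU/√π) κ e^{1/4} e^{−κ|s|}` (`ΔU ≥ 0`). [folklore] -/
theorem burgersLayerProfileD_le_exp {γ ν ΔU : ℝ} (hΔU : 0 ≤ ΔU) (s : ℝ) :
    burgersLayerProfileD γ ν ΔU s ≤
      ΔU / Real.sqrt Real.pi * burgersLayerRate γ ν * Real.exp (1 / 4) *
        Real.exp (-burgersLayerRate γ ν * |s|) := by
  unfold burgersLayerProfileD
  have hκ : 0 ≤ burgersLayerRate γ ν := Real.sqrt_nonneg _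
  have hc : 0 ≤ ΔU / Real.sqrt Real.pi * burgersLayerRate γ ν := by positivity
  have he := exp_neg_mul_sq_le_exp_neg_abs (burgersLayerRate γ ν) s
  calc ΔU / Real.sqrt Real.pi * (burgersLayerRate γ ν * Real.exp (-(burgersLayerRate γ ν * s) ^ 2))
      = ΔU / Real.sqrt Real.pi * burgersLayerRate γ ν * Real.exp (-(burgersLayerRate γ ν * s) ^ 2) := by
        ring
    _ ≤ ΔU / Real.sqrt Real.pi * burgersLayerRate γ ν *
          (Real.exp (1 / 4) * Real.exp (-burgersLayerRate γ ν * |s|)) := mul_le_mul_of_nonneg_left he hc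
    _ = _ := by ring

/-- **Tail of `U_B''`**: `|U_B''(s)| ≤ 2κ²(ΔU/√π)·e·e^{−κ|s|}` (`ΔU ≥ 0`). [folklore] -/
theorem abs_burgersLayerProfileDD_le_exp {γ ν ΔU : ℝ} (hΔU : 0 ≤ ΔU) (s : ℝ) :
    |burgersLayerProfileDD γ ν ΔU s| ≤
      2 * burgersLayerRate γ ν ^ 2 * (ΔU / Real.sqrt Real.pi) * Real.exp 1 *
        Real.exp (-burgersLayerRate γ ν * |s|) := by
  have hκ : 0 ≤ burgersLayerRate γ ν := Real.sqrt_nonneg _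
  have hD0 : 0 ≤ burgersLayerProfileD γ ν ΔU s := burgersLayerProfileD_nonneg γ ν hΔU s
  have hc : 0 ≤ 2 * burgersLayerRate γ ν ^ 2 * (ΔU / Real.sqrt Real.pi) := by positivity
  have h1 : |burgersLayerProfileDD γ ν ΔU s| =
      2 * burgersLayerRate γ ν ^ 2 * |s| * burgersLayerProfileD γ ν ΔU s := by
    rw [burgersLayerProfileDD, abs_mul, abs_neg, abs_mul,
      abs_of_nonneg (by positivity : (0:ℝ) ≤ 2 * burgersLayerRate γ ν ^ 2), abs_of_nonneg hD0]
  have h2 : 2 * burgersLayerRate γ ν ^ 2 * |s| * burgersLayerProfileD γ ν ΔU s =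
      2 * burgersLayerRate γ ν ^ 2 * (ΔU / Real.sqrt Real.pi) *
        (burgersLayerRate γ ν * |s| * Real.exp (-(burgersLayerRate γ ν * s) ^ 2)) := by
    unfold burgersLayerProfileD; ring
  rw [h1, h2]
  calc 2 * burgersLayerRate γ ν ^ 2 * (ΔU / Real.sqrt Real.pi) *
        (burgersLayerRate γ ν * |s| * Real.exp (-(burgersLayerRate γ ν * s) ^ 2))
      ≤ 2 * burgersLayerRate γ ν ^ 2 * (ΔU / Real.sqrt Real.pi) *
          (Real.exp 1 * Real.exp (-burgersLayerRate γ ν * |s|)) :=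
        mul_le_mul_of_nonneg_left (mul_abs_mul_exp_neg_mul_sq_le hκ s) hc
    _ = _ := by ring

/-- **Upper tail of the profile**: for `y ≥ 0`, `ΔU/2 − U_B(y) ≤ (ΔU/√π) e^{1/4} e^{−κy}` (`γ, ν > 0`,
`ΔU ≥ 0`; integrate the tail of `U_B'` over `(y, ∞)`). [folklore] -/
theorem half_sub_burgersLayerProfile_le {γ ν ΔU : ℝ} (hγ : 0 < γ) (hν : 0 < ν) (hΔU : 0 ≤ ΔU) {y : ℝ}
    (hy : 0 ≤ y) :
    ΔU / 2 - burgersLayerProfile γ ν ΔU y ≤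
      ΔU / Real.sqrt Real.pi * Real.exp (1 / 4) * Real.exp (-burgersLayerRate γ ν * y) := by
  set κ := burgersLayerRate γ ν with hκdef
  have hκ : 0 < κ := burgersLayerRate_pos hγ hν
  -- `ΔU/2 − U_B(y) = ∫_{(y,∞)} U_B'`
  have hFTC : ∫ s in Ioi y, burgersLayerProfileD γ ν ΔU s = ΔU / 2 - burgersLayerProfile γ ν ΔU y :=
    integral_Ioi_of_hasDerivAt_of_tendsto' (fun s _ => hasDerivAt_burgersLayerProfile' γ ν ΔU s)
      (integrable_burgersLayerProfileD hγ hν ΔU).integrableOn (tendsto_burgersLayerProfile_atTop hγ hν ΔU)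
  -- the exponential majorant and its integral
  set A : ℝ := ΔU / Real.sqrt Real.pi * κ * Real.exp (1 / 4) with hA
  have hA0 : 0 ≤ A := by positivity
  have hmaj_int : IntegrableOn (fun s => A * Real.exp (-κ * s)) (Ioi y) :=
    (integrableOn_exp_mul_Ioi (neg_lt_zero.2 hκ) y).const_mul A
  have hmaj_val : ∫ s in Ioi y, A * Real.exp (-κ * s) = A / κ * Real.exp (-κ * y) := by
    rw [integral_const_mul, integral_exp_mul_Ioi (neg_lt_zero.2 hκ) y]
    field_simp
  have hle : ∫ s in Ioi y, burgersLayerProfileD γ ν ΔU s ≤ ∫ s in Ioi y, A * Real.exp (-κ * s) := by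
    refine setIntegral_mono_on (integrable_burgersLayerProfileD hγ hν ΔU).integrableOn hmaj_int
      measurableSet_Ioi fun s hs => ?_
    have hs0 : 0 ≤ s := hy.trans (le_of_lt hs)
    have := burgersLayerProfileD_le_exp (γ := γ) (ν := ν) hΔU s
    rwa [abs_of_nonneg hs0] at this
  rw [← hFTC]
  refine hle.trans ?_
  rw [hmaj_val, hA]
  have : ΔU / Real.sqrt Real.pi * κ * Real.exp (1 / 4) / κ = ΔU / Real.sqrt Real.pi * Real.exp (1 / 4) := by
    field_simp
  rw [this]

/-- **Lower tail of the profile**: for `y ≤ 0`, `U_B(y) + ΔU/2 ≤ (ΔU/√π) e^{1/4} e^{−κ|y|}` (oddness). [folklore] -/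
theorem burgersLayerProfile_add_half_le {γ ν ΔU : ℝ} (hγ : 0 < γ) (hν : 0 < ν) (hΔU : 0 ≤ ΔU) {y : ℝ}
    (hy : y ≤ 0) :
    burgersLayerProfile γ ν ΔU y + ΔU / 2 ≤
      ΔU / Real.sqrt Real.pi * Real.exp (1 / 4) * Real.exp (-burgersLayerRate γ ν * |y|) := by
  have h := half_sub_burgersLayerProfile_le hγ hν hΔU (neg_nonneg.2 hy)
  rw [burgersLayerProfile_neg, abs_of_nonpos hy] at *
  linarith

/-- **Tail of the shear quantity**: `|U_B(y)² − ΔU²/4| ≤ ΔU (ΔU/√π) e^{1/4} e^{−κ|y|}` (`γ, ν > 0`, `ΔU ≥ 0`):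
`U_B² − ΔU²/4 = (U_B − ΔU/2)(U_B + ΔU/2)` with one factor exponentially small and the other `≤ ΔU`. [folklore] -/
theorem abs_burgersLayerProfile_sq_sub_le {γ ν ΔU : ℝ} (hγ : 0 < γ) (hν : 0 < ν) (hΔU : 0 ≤ ΔU) (y : ℝ) :
    |burgersLayerProfile γ ν ΔU y ^ 2 - ΔU ^ 2 / 4| ≤
      ΔU * (ΔU / Real.sqrt Real.pi * Real.exp (1 / 4)) * Real.exp (-burgersLayerRate γ ν * |y|) := by
  set U := burgersLayerProfile γ ν ΔU y with hU
  set B := ΔU / Real.sqrt Real.pi * Real.exp (1 / 4) * Real.exp (-burgersLayerRate γ ν * |y|) with hB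
  have hB0 : 0 ≤ B := by positivity
  have hup : U ≤ ΔU / 2 := burgersLayerProfile_le_half hγ hν hΔU y
  have hlo : -(ΔU / 2) ≤ U := neg_half_le_burgersLayerProfile hγ hν hΔU y
  have hfac : U ^ 2 - ΔU ^ 2 / 4 = (U - ΔU / 2) * (U + ΔU / 2) := by ring
  rw [hfac, abs_mul]
  rcases le_total 0 y with hy | hy
  · -- `y ≥ 0`: the first factor is small
    have h1 : |U - ΔU / 2| ≤ B := by
      rw [abs_of_nonpos (by linarith), neg_sub, hB, abs_of_nonneg hy]
      exact half_sub_burgersLayerProfile_le hγ hν hΔU hy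
    have h2 : |U + ΔU / 2| ≤ ΔU := by rw [abs_of_nonneg (by linarith)]; linarith
    calc |U - ΔU / 2| * |U + ΔU / 2| ≤ B * ΔU :=
          mul_le_mul h1 h2 (abs_nonneg _) hB0
      _ = ΔU * (ΔU / Real.sqrt Real.pi * Real.exp (1 / 4)) * Real.exp (-burgersLayerRate γ ν * |y|) := by
          rw [hB]; ring
  · -- `y ≤ 0`: the second factor is small
    have h1 : |U + ΔU / 2| ≤ B := by
      rw [abs_of_nonneg (by linarith), hB]
      exact burgersLayerProfile_add_half_le hγ hν hΔU hy
    have h2 : |U - ΔU / 2| ≤ ΔU := by rw [abs_of_nonpos (by linarith)]; linarith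
    calc |U - ΔU / 2| * |U + ΔU / 2| ≤ ΔU * B :=
          mul_le_mul h2 h1 (abs_nonneg _) hΔU
      _ = ΔU * (ΔU / Real.sqrt Real.pi * Real.exp (1 / 4)) * Real.exp (-burgersLayerRate γ ν * |y|) := by
          rw [hB]; ring

/-! ### The Burgers shear layer has shear-layer tails -/

/-- **The laminar state satisfies the shear-layer tails side condition** (`γ, ν > 0`, `ΔU = 1`):
`HasShearLayerTails (burgersShearLayer γ ν 1) 0`. Clause (i): `|U_B| + |U_B'| ≤ ½ + κ/√π` and `∂ₓ ≡ 0`;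
clause (ii): `|U_B² − ¼| + |U_B'| + |U_B''| ≤ C′e^{−κ|y|}` by the Gaussian tails above, all `x`- and
`t`-derivatives and `v` vanish. In particular the recommended class repair of the strained-layer statements
keeps the unperturbed layer inside the class (non-vacuity). [folklore] -/
theorem hasShearLayerTails_burgersShearLayer {γ ν : ℝ} (hγ : 0 < γ) (hν : 0 < ν) :
    HasShearLayerTails (burgersShearLayer γ ν 1) (fun _ _ _ => 0) := by
  intro T _hT
  set κ := burgersLayerRate γ ν with hκdef
  have hκ : 0 < κ := burgersLayerRate_pos hγ hν
  have h01 : (0:ℝ) ≤ 1 := zero_le_one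
  refine ⟨⟨1 / 2 + 1 / Real.sqrt Real.pi * κ, 1, one_pos, fun t _ x y => ⟨?_, ?_⟩⟩, fun δ _ => ?_⟩
  · -- clause (i), bounded quantities
    have hU : |burgersLayerProfile γ ν 1 y| ≤ 1 / 2 := abs_burgersLayerProfile_le hγ hν h01 y
    have hD : |burgersLayerProfileD γ ν 1 y| ≤ 1 / Real.sqrt Real.pi * κ := by
      rw [abs_of_nonneg (burgersLayerProfileD_nonneg γ ν h01 y)]
      exact burgersLayerProfileD_le h01 y
    simp only [burgersShearLayer_apply, dY_burgersShearLayer, abs_zero, add_zero]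
    simpa [dY] using add_le_add hU hD
  · -- clause (i), `x`-derivatives vanish
    have hC : 0 ≤ (1 / 2 + 1 / Real.sqrt Real.pi * κ) * Real.exp (-1 * |y|) := by positivity
    simpa [dX] using hC
  · -- clause (ii)
    set C' : ℝ := 1 * (1 / Real.sqrt Real.pi * Real.exp (1 / 4)) +
        1 / Real.sqrt Real.pi * κ * Real.exp (1 / 4) + 2 * κ ^ 2 * (1 / Real.sqrt Real.pi) * Real.exp 1
      with hC'
    refine ⟨C', κ, hκ, fun t _ x y => ?_⟩
    have e1 : |burgersLayerProfile γ ν 1 y ^ 2 - 1 / 4| ≤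
        1 * (1 / Real.sqrt Real.pi * Real.exp (1 / 4)) * Real.exp (-κ * |y|) := by
      have := abs_burgersLayerProfile_sq_sub_le hγ hν h01 y
      norm_num at this ⊢
      exact this
    have e2 : |burgersLayerProfileD γ ν 1 y| ≤ 1 / Real.sqrt Real.pi * κ * Real.exp (1 / 4) * Real.exp (-κ * |y|) := by
      rw [abs_of_nonneg (burgersLayerProfileD_nonneg γ ν h01 y)]
      exact burgersLayerProfileD_le_exp h01 y
    have e3 : |burgersLayerProfileDD γ ν 1 y| ≤
        2 * κ ^ 2 * (1 / Real.sqrt Real.pi) * Real.exp 1 * Real.exp (-κ * |y|) :=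
      abs_burgersLayerProfileDD_le_exp h01 y
    have hsum : |burgersLayerProfile γ ν 1 y ^ 2 - 1 / 4| + |burgersLayerProfileD γ ν 1 y| +
        |burgersLayerProfileDD γ ν 1 y| ≤ C' * Real.exp (-κ * |y|) := by
      rw [hC']; nlinarith [e1, e2, e3, Real.exp_pos (-κ * |y|)]
    have q1 : dX (burgersShearLayer γ ν 1 t) x y = 0 := by simp
    have q2 : dY (burgersShearLayer γ ν 1 t) x y = burgersLayerProfileD γ ν 1 y := by simp
    have q3 : dX (dX (burgersShearLayer γ ν 1 t)) x y = 0 := by simp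
    have q4 : dY (dY (burgersShearLayer γ ν 1 t)) x y = burgersLayerProfileDD γ ν 1 y := by
      rw [dY_dY_burgersShearLayer]
    have q5 : deriv (fun s => burgersShearLayer γ ν 1 s x y) t = 0 := by simp
    have q6 : dX (fun _ _ : ℝ => (0:ℝ)) x y = 0 := by simp [dX]
    have q7 : dY (fun _ _ : ℝ => (0:ℝ)) x y = 0 := by simp [dY]
    have q8 : dX (dX (fun _ _ : ℝ => (0:ℝ))) x y = 0 := by simp [dX]
    have q9 : dY (dY (fun _ _ : ℝ => (0:ℝ))) x y = 0 := by simp [dY]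
    have q10 : deriv (fun _ : ℝ => (0:ℝ)) t = 0 := deriv_const t 0
    rw [q1, q2, q3, q4, q5]
    simp only [burgersShearLayer_apply, q6, q7, q8, q9, q10, abs_zero, add_zero, zero_add, ne_eq,
      OfNat.ofNat_ne_zero, not_false_eq_true, zero_pow]
    linarith [hsum]

end Literature.Analysis.FluidPDE

end
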